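import Mathlib
import Literature.Analysis.Calculus.FoldBirthOfZeros
import Literature.Analysis.Calculus.MixedPartials

/-!
# Birth of a bigon: two arcs of an evolving plane curve through a generic self-tangency

Analysis/Calculus proof file (Mathlib + `FoldBirthOfZeros`, `MixedPartials`; theorems only).

Let `Γ : ℝ → ℝ → ℝ × ℝ`, `(t, s) ↦ Γ t s`, be a `C²` family of plane curves and let the curve
`Γ 0` touch itself: `Γ 0 α = Γ 0 β` with parallel velocities at `α` and `β`, both with non-zero
first component (the common tangent is not vertical). In the **adapted coordinates** — the two arcs
near `α` and `β` reparametrised by the first coordinate, `s = φ t x`, `u = ψ t x`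
(`Literature.Analysis.Calculus.exists_graph_reparam`), so that they are the graphs of
`x ↦ (Γ t (φ t x)).2` and `x ↦ (Γ t (ψ t x)).2` — let the difference of heights
`f t x = (Γ t (ψ t x)).2 - (Γ t (φ t x)).2` satisfy the generic fold conditions
`∂ₓₓ f (0, x₀) > 0`, `∂ₜ f (0, x₀) < 0` at `x₀ = (Γ 0 α).1` (`f = ∂ₓ f = 0` there is the
tangency). Then (`bigon_birth`) there are a radius `η` and a time `δ` such that, within the
parameter windows `|s - α| < η`, `|u - β| < η` (on which each `Γ t` is injective):

* for `t ∈ (-δ, 0)` the two arcs do not meet;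
* for `t ∈ (0, δ)` they meet in exactly two points `Γ t s₁ = Γ t u₁`, `Γ t s₂ = Γ t u₂`, and the
  determinants `det (Γₜ' sᵢ, Γₜ' uᵢ)` of the two crossings are non-zero of opposite signs.

This is the local model of the **second Reidemeister move** along a generic isotopy of knot
diagrams (a bigon is born through a self-tangency), used towards
`Literature.Topology.FourManifolds.Knot.reidemeisterR`: the zeros of `f t` are counted by the
fold bifurcation `fold_birth_of_two_zeros_le`, transported to the arcs by the reparametrisations,
and the crossing determinants are `∂ₓ f / (φₓ ψₓ)` by the chain rule.

## References

* K. Reidemeister, *Knotentheorie*, Springer (1932), Kap. I §1 (the move `Ω2`). [Reidemeister1932]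
* Yu. A. Kuznetsov, *Elements of Applied Bifurcation Theory*, Springer (2023), §3.3, Thm. 3.1
  (generic fold). [Kuznetsov2023]
-/

noncomputable section

open scoped Topology
open Filter Set Function Metric

namespace Literature.Analysis.Calculus

/-- Two real numbers closer than the modulus of the second have a positive product (same sign).
[folklore] -/
theorem mul_pos_of_abs_sub_lt {c c₀ : ℝ} (h : |c - c₀| < |c₀|) : 0 < c * c₀ := by
  rcases lt_trichotomy c₀ 0 with h0 | rfl | h0
  · rw [abs_of_neg h0] at h
    have : c < 0 := by linarith [(abs_sub_lt_iff.1 h).1, (abs_sub_lt_iff.1 h).2]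
    exact mul_pos_of_neg_of_neg this h0
  · simp only [sub_zero, abs_zero] at h
    exact absurd h (not_lt.2 (abs_nonneg c))
  · rw [abs_of_pos h0] at h
    have : 0 < c := by linarith [(abs_sub_lt_iff.1 h).1, (abs_sub_lt_iff.1 h).2]
    exact mul_pos this h0

/-- Real numbers with a negative product have opposite signs. [folklore] -/
theorem sign_eq_neg_sign_of_mul_neg {p q : ℝ} (h : p * q < 0) :
    SignType.sign p = -SignType.sign q := by
  rcases lt_trichotomy p 0 with hp | rfl | hp
  · have hq : 0 < q := by nlinarith
    simp [sign_neg hp, sign_pos hq]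
  · simp at h
  · have hq : q < 0 := by nlinarith
    simp [sign_pos hp, sign_neg hq]

/-- **Birth of a bigon through a generic self-tangency** (local model of the second
Reidemeister move). See the module docstring for the setting: `Γ` a `C²` family of plane curves,
`Γ 0 α = Γ 0 β` a tangency with non-vertical tangent, `φ, ψ` the reparametrisations of the two
arcs by the first coordinate near `x₀ = (Γ 0 α).1` (with their inverse identities on boxes of
size `δ₁` and their derivatives at the base point), and the fold conditions on the difference of
heights. Conclusion: windows `|s - α| < η`, `|u - β| < η` (`η` below any prescribed `ηmax`) of injectivity of every
`Γ t`, `|t| < δ`,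
in which the two arcs are disjoint for `t ∈ (-δ, 0)` and cross exactly twice, with non-zero
determinants of opposite signs, for `t ∈ (0, δ)`. [cite: Reidemeister1932, Kap. I §1] -/
theorem bigon_birth {Γ : ℝ → ℝ → ℝ × ℝ} (hΓ : ContDiff ℝ 2 (uncurry Γ)) {α β : ℝ}
    (hαβ : Γ 0 α = Γ 0 β) (hα1 : (deriv (Γ 0) α).1 ≠ 0) (hβ1 : (deriv (Γ 0) β).1 ≠ 0)
    (htan : (deriv (Γ 0) α).1 * (deriv (Γ 0) β).2 = (deriv (Γ 0) α).2 * (deriv (Γ 0) β).1)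
    {φ ψ : ℝ → ℝ → ℝ} {δ₁ : ℝ} (hδ₁ : 0 < δ₁)
    (hφC : ContDiffAt ℝ 2 (uncurry φ) (0, (Γ 0 α).1)) (hφ0 : φ 0 (Γ 0 α).1 = α)
    (hφr : ∀ t x, |t| < δ₁ → |x - (Γ 0 α).1| < δ₁ → (Γ t (φ t x)).1 = x)
    (hφl : ∀ t s, |t| < δ₁ → |s - α| < δ₁ → φ t (Γ t s).1 = s)
    (hφd : HasDerivAt (φ 0) ((deriv (Γ 0) α).1)⁻¹ (Γ 0 α).1)
    (hψC : ContDiffAt ℝ 2 (uncurry ψ) (0, (Γ 0 α).1)) (hψ0 : ψ 0 (Γ 0 α).1 = β)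
    (hψr : ∀ t x, |t| < δ₁ → |x - (Γ 0 α).1| < δ₁ → (Γ t (ψ t x)).1 = x)
    (hψl : ∀ t u, |t| < δ₁ → |u - β| < δ₁ → ψ t (Γ t u).1 = u)
    (hψd : HasDerivAt (ψ 0) ((deriv (Γ 0) β).1)⁻¹ (Γ 0 α).1)
    (hxx : 0 < deriv (deriv fun x ↦ (Γ 0 (ψ 0 x)).2 - (Γ 0 (φ 0 x)).2) (Γ 0 α).1)
    (ht : deriv (fun t ↦ (Γ t (ψ t (Γ 0 α).1)).2 - (Γ t (φ t (Γ 0 α).1)).2) 0 < 0)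
    {ηmax : ℝ} (hηmax : 0 < ηmax) :
    ∃ η > 0, η ≤ ηmax ∧ ∃ δ > 0,
      (∀ t s s', |t| < δ → |s - α| < η → |s' - α| < η → Γ t s = Γ t s' → s = s') ∧
      (∀ t u u', |t| < δ → |u - β| < η → |u' - β| < η → Γ t u = Γ t u' → u = u') ∧
      (∀ t s u, -δ < t → t < 0 → |s - α| < η → |u - β| < η → Γ t s ≠ Γ t u) ∧
      ∀ t, 0 < t → t < δ → ∃ s₁ u₁ s₂ u₂ : ℝ,
        |s₁ - α| < η ∧ |s₂ - α| < η ∧ |u₁ - β| < η ∧ |u₂ - β| < η ∧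
        Γ t s₁ = Γ t u₁ ∧ Γ t s₂ = Γ t u₂ ∧ (Γ t s₁).1 < (Γ t s₂).1 ∧
        (∀ s u, |s - α| < η → |u - β| < η → Γ t s = Γ t u →
          (s = s₁ ∧ u = u₁) ∨ (s = s₂ ∧ u = u₂)) ∧
        (deriv (Γ t) s₁).1 * (deriv (Γ t) u₁).2 - (deriv (Γ t) s₁).2 * (deriv (Γ t) u₁).1 ≠ 0 ∧
        SignType.sign ((deriv (Γ t) s₁).1 * (deriv (Γ t) u₁).2
            - (deriv (Γ t) s₁).2 * (deriv (Γ t) u₁).1)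
          = -SignType.sign ((deriv (Γ t) s₂).1 * (deriv (Γ t) u₂).2
            - (deriv (Γ t) s₂).2 * (deriv (Γ t) u₂).1) := by
  -- if `a p > 0` and `b p > 0` then `a b > 0`
  have mpp : ∀ {a b p : ℝ}, 0 < a * p → 0 < b * p → 0 < a * b := fun {a b p} ha hb ↦ by
    nlinarith [mul_pos ha hb, sq_nonneg p, sq_nonneg (a * b)]
  have h20 : (2 : WithTop ℕ∞) ≠ 0 := two_ne_zero
  set x₀ : ℝ := (Γ 0 α).1 with hx₀
  -- the curves of the family, their velocities `D (t, s) = Γₜ' s`, continuity of `D`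
  have hγ : ∀ t, ContDiff ℝ 2 (Γ t) := fun t ↦ hΓ.comp (contDiff_const.prodMk contDiff_id)
  have hγd : ∀ t s, HasDerivAt (Γ t) (deriv (Γ t) s) s := fun t s ↦
    (((hγ t).differentiable h20) s).hasDerivAt
  set D : ℝ × ℝ → ℝ × ℝ := fun p ↦ fderiv ℝ (uncurry Γ) p (0, 1) with hD
  have hDc : Continuous D := (hΓ.continuous_fderiv h20).clm_apply continuous_const
  have hDeq : ∀ t s, deriv (Γ t) s = D (t, s) := fun t s ↦ by
    have h := (hasDerivAt_curry_right (q := (t, s)) ((hΓ.differentiable h20) _)).deriv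
    exact h
  -- the heights of the two arcs over `x` and their difference `f`; the shifted `g`
  set a : ℝ → ℝ → ℝ := fun t x ↦ (Γ t (φ t x)).2 with ha
  set b : ℝ → ℝ → ℝ := fun t x ↦ (Γ t (ψ t x)).2 with hb
  set f : ℝ → ℝ → ℝ := fun t x ↦ b t x - a t x with hf
  set g : ℝ → ℝ → ℝ := fun t y ↦ f t (x₀ + y) with hg
  -- smoothness of `a`, `b`, `f`, `g` at the base point
  have haC : ContDiffAt ℝ 2 (uncurry a) (0, x₀) := by
    have hpair : ContDiffAt ℝ 2 (fun p : ℝ × ℝ ↦ ((p.1, uncurry φ p) : ℝ × ℝ)) (0, x₀) :=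
      contDiffAt_fst.prodMk hφC
    have hcomp : ContDiffAt ℝ 2 (uncurry Γ ∘ fun p : ℝ × ℝ ↦ ((p.1, uncurry φ p) : ℝ × ℝ))
        (0, x₀) :=
      ContDiffAt.comp (f := fun p : ℝ × ℝ ↦ ((p.1, uncurry φ p) : ℝ × ℝ)) (0, x₀)
        hΓ.contDiffAt hpair
    exact contDiffAt_snd.comp _ hcomp
  have hbC : ContDiffAt ℝ 2 (uncurry b) (0, x₀) := by
    have hpair : ContDiffAt ℝ 2 (fun p : ℝ × ℝ ↦ ((p.1, uncurry ψ p) : ℝ × ℝ)) (0, x₀) :=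
      contDiffAt_fst.prodMk hψC
    have hcomp : ContDiffAt ℝ 2 (uncurry Γ ∘ fun p : ℝ × ℝ ↦ ((p.1, uncurry ψ p) : ℝ × ℝ))
        (0, x₀) :=
      ContDiffAt.comp (f := fun p : ℝ × ℝ ↦ ((p.1, uncurry ψ p) : ℝ × ℝ)) (0, x₀)
        hΓ.contDiffAt hpair
    exact contDiffAt_snd.comp _ hcomp
  have hfC : ContDiffAt ℝ 2 (uncurry f) (0, x₀) := hbC.sub haC
  have hgC : ContDiffAt ℝ 2 (uncurry g) (0, 0) := by
    have hsh : ContDiffAt ℝ 2 (fun p : ℝ × ℝ ↦ ((p.1, x₀ + p.2) : ℝ × ℝ)) (0, 0) :=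
      contDiffAt_fst.prodMk (contDiffAt_const.add contDiffAt_snd)
    have hfC' : ContDiffAt ℝ 2 (uncurry f) ((fun p : ℝ × ℝ ↦ ((p.1, x₀ + p.2) : ℝ × ℝ)) (0, 0)) := by
      simpa using hfC
    exact ContDiffAt.comp (f := fun p : ℝ × ℝ ↦ ((p.1, x₀ + p.2) : ℝ × ℝ)) (0, 0) hfC' hsh
  -- values and first derivatives at the base point
  have hβx : (Γ 0 β).1 = x₀ := by rw [hx₀, hαβ]
  have hg0 : g 0 0 = 0 := by
    simp only [hg, hf, ha, hb, add_zero, hφ0, hψ0, hαβ, sub_self]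
  have hda0 : HasDerivAt (a 0) (((deriv (Γ 0) α).1)⁻¹ * (deriv (Γ 0) α).2) x₀ := by
    have h1 : HasDerivAt (Γ 0) (deriv (Γ 0) α) (φ 0 x₀) := by rw [hφ0]; exact hγd 0 α
    have h2 : HasDerivAt (fun x ↦ (Γ 0 (φ 0 x)).2)
        ((((deriv (Γ 0) α).1)⁻¹ • deriv (Γ 0) α).2) x₀ :=
      (ContinuousLinearMap.snd ℝ ℝ ℝ).hasFDerivAt.comp_hasDerivAt x₀ (h1.scomp x₀ hφd)
    exact h2
  have hdb0 : HasDerivAt (b 0) (((deriv (Γ 0) β).1)⁻¹ * (deriv (Γ 0) β).2) x₀ := by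
    have h1 : HasDerivAt (Γ 0) (deriv (Γ 0) β) (ψ 0 x₀) := by rw [hψ0]; exact hγd 0 β
    have h2 : HasDerivAt (fun x ↦ (Γ 0 (ψ 0 x)).2)
        ((((deriv (Γ 0) β).1)⁻¹ • deriv (Γ 0) β).2) x₀ :=
      (ContinuousLinearMap.snd ℝ ℝ ℝ).hasFDerivAt.comp_hasDerivAt x₀ (h1.scomp x₀ hψd)
    exact h2
  have hdf0 : deriv (f 0) x₀ = 0 := by
    have h := (hdb0.sub hda0).deriv
    have e : f 0 = b 0 - a 0 := rfl
    rw [e, h]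
    field_simp
    linarith
  have hgx : deriv (g 0) 0 = 0 := by
    have e : g 0 = fun y ↦ f 0 (x₀ + y) := rfl
    rw [e, deriv_comp_const_add, add_zero, hdf0]
  have hgxx : 0 < deriv (deriv (g 0)) 0 := by
    have e : deriv (g 0) = fun y ↦ deriv (f 0) (x₀ + y) := by
      funext y
      exact deriv_comp_const_add (f := f 0) x₀ y
    rw [e, deriv_comp_const_add, add_zero]
    exact hxx
  have hgt : deriv (fun t ↦ g t 0) 0 < 0 := by
    have e : (fun t ↦ g t 0) = fun t ↦ (Γ t (ψ t x₀)).2 - (Γ t (φ t x₀)).2 := by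
      funext t
      simp only [hg, hf, ha, hb, add_zero]
    rw [e]
    exact ht
  -- (1) boxes: differentiability of `φ`, `ψ` near the base point
  obtain ⟨δ₆, hδ₆, hbox₆⟩ : ∃ δ₆ > 0, ∀ t x, |t| < δ₆ → |x - x₀| < δ₆ →
      ContDiffAt ℝ 2 (uncurry φ) (t, x) ∧ ContDiffAt ℝ 2 (uncurry ψ) (t, x) := by
    obtain ⟨r, hr, h⟩ := Metric.eventually_nhds_iff.1
      ((hφC.eventually (by simp)).and (hψC.eventually (by simp)))
    refine ⟨r, hr, fun t x ht hx ↦ h ?_⟩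
    rw [Prod.dist_eq, Real.dist_eq, Real.dist_eq, sub_zero]
    exact max_lt ht hx
  -- (2) the fold, first in a window inside the boxes
  obtain ⟨ρ, hρ, hρle, δ₂, hδ₂, -, hnone, htwo⟩ :=
    fold_birth_of_two_zeros_le hgC hg0 hgx hgxx hgt (lt_min hδ₁ hδ₆)
  have hρ₁ : ρ ≤ δ₁ := hρle.trans (min_le_left _ _)
  have hρ₆ : ρ ≤ δ₆ := hρle.trans (min_le_right _ _)
  -- (3) parameter windows: first coordinates fall into the fold window, velocities keep the sign
  --     of their first components
  have hc₀α : 0 < |(D (0, α)).1| := abs_pos.2 (by rw [← hDeq]; exact hα1)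
  have hc₀β : 0 < |(D (0, β)).1| := abs_pos.2 (by rw [← hDeq]; exact hβ1)
  have hwin : ∀ (γ₀ : ℝ), (Γ 0 γ₀).1 = x₀ → 0 < |(D (0, γ₀)).1| → ∃ η₀ > 0, ∀ t s, |t| < η₀ →
      |s - γ₀| < η₀ → |(Γ t s).1 - x₀| < ρ ∧ |(D (t, s)).1 - (D (0, γ₀)).1| < |(D (0, γ₀)).1| := by
    intro γ₀ hγ₀ hc₀
    have h1 : ∀ᶠ p in 𝓝 ((0 : ℝ), γ₀), dist (uncurry Γ p) (uncurry Γ (0, γ₀)) < ρ :=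
      Metric.tendsto_nhds.1 hΓ.continuous.continuousAt ρ hρ
    have h2 : ∀ᶠ p in 𝓝 ((0 : ℝ), γ₀), dist (D p) (D (0, γ₀)) < |(D (0, γ₀)).1| :=
      Metric.tendsto_nhds.1 hDc.continuousAt _ hc₀
    obtain ⟨r, hr, h⟩ := Metric.eventually_nhds_iff.1 (h1.and h2)
    refine ⟨r, hr, fun t s ht hs ↦ ?_⟩
    have hd : dist ((t, s) : ℝ × ℝ) (0, γ₀) < r := by
      rw [Prod.dist_eq, Real.dist_eq, Real.dist_eq, sub_zero]
      exact max_lt ht hs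
    obtain ⟨hA, hB⟩ := h hd
    rw [dist_eq_norm] at hA hB
    refine ⟨?_, ?_⟩
    · have h3 := norm_fst_le (uncurry Γ (t, s) - uncurry Γ (0, γ₀))
      rw [Prod.fst_sub, Real.norm_eq_abs] at h3
      have h4 : (uncurry Γ (t, s)).1 - (uncurry Γ (0, γ₀)).1 = (Γ t s).1 - x₀ := by
        rw [← hγ₀]; rfl
      rw [h4] at h3
      exact h3.trans_lt hA
    · have h3 := norm_fst_le (D (t, s) - D (0, γ₀))
      rw [Prod.fst_sub, Real.norm_eq_abs] at h3
      exact h3.trans_lt hB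
  obtain ⟨η₁, hη₁, hboxα⟩ := hwin α rfl hc₀α
  obtain ⟨η₂, hη₂, hboxβ⟩ := hwin β hβx hc₀β
  set η : ℝ := min (min (min η₁ η₂) δ₁) ηmax with hη
  have hη0 : 0 < η := lt_min (lt_min (lt_min hη₁ hη₂) hδ₁) hηmax
  have hηη₁ : η ≤ η₁ := ((min_le_left _ _).trans (min_le_left _ _)).trans (min_le_left _ _)
  have hηη₂ : η ≤ η₂ := ((min_le_left _ _).trans (min_le_left _ _)).trans (min_le_right _ _)
  have hηδ₁ : η ≤ δ₁ := (min_le_left _ _).trans (min_le_right _ _)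
  have hηmax' : η ≤ ηmax := min_le_right _ _
  -- (4) a smaller fold window whose reparametrised points fall into the parameter windows
  obtain ⟨ρ', hρ', hboxφψ⟩ : ∃ ρ' > 0, ∀ t x, |t| < ρ' → |x - x₀| < ρ' →
      |φ t x - α| < η ∧ |ψ t x - β| < η := by
    have h1 : ∀ᶠ p in 𝓝 ((0 : ℝ), x₀), dist (uncurry φ p) (uncurry φ (0, x₀)) < η :=
      Metric.tendsto_nhds.1 hφC.continuousAt η hη0
    have h2 : ∀ᶠ p in 𝓝 ((0 : ℝ), x₀), dist (uncurry ψ p) (uncurry ψ (0, x₀)) < η :=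
      Metric.tendsto_nhds.1 hψC.continuousAt η hη0
    obtain ⟨r, hr, h⟩ := Metric.eventually_nhds_iff.1 (h1.and h2)
    refine ⟨r, hr, fun t x ht hx ↦ ?_⟩
    have hd : dist ((t, x) : ℝ × ℝ) (0, x₀) < r := by
      rw [Prod.dist_eq, Real.dist_eq, Real.dist_eq, sub_zero]
      exact max_lt ht hx
    obtain ⟨hA, hB⟩ := h hd
    rw [Real.dist_eq] at hA hB
    have eA : uncurry φ (t, x) - uncurry φ (0, x₀) = φ t x - α := by rw [← hφ0]; rfl
    have eB : uncurry ψ (t, x) - uncurry ψ (0, x₀) = ψ t x - β := by rw [← hψ0]; rfl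
    rw [eA] at hA
    rw [eB] at hB
    exact ⟨hA, hB⟩
  obtain ⟨ρ'', hρ'', hρ''le, δ₅, hδ₅, -, -, htwo'⟩ :=
    fold_birth_of_two_zeros_le hgC hg0 hgx hgxx hgt (lt_min hρ' hρ)
  have hρ''ρ' : ρ'' ≤ ρ' := hρ''le.trans (min_le_left _ _)
  have hρ''ρ : ρ'' ≤ ρ := hρ''le.trans (min_le_right _ _)
  -- (5) the time `δ`
  set δ : ℝ := min (min (min δ₁ δ₂) (min η₁ η₂)) (min (min ρ' δ₅) δ₆) with hδ
  have hδ0 : 0 < δ :=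
    lt_min (lt_min (lt_min hδ₁ hδ₂) (lt_min hη₁ hη₂)) (lt_min (lt_min hρ' hδ₅) hδ₆)
  have hδδ₁ : δ ≤ δ₁ := ((min_le_left _ _).trans (min_le_left _ _)).trans (min_le_left _ _)
  have hδδ₂ : δ ≤ δ₂ := ((min_le_left _ _).trans (min_le_left _ _)).trans (min_le_right _ _)
  have hδη₁ : δ ≤ η₁ := ((min_le_left _ _).trans (min_le_right _ _)).trans (min_le_left _ _)
  have hδη₂ : δ ≤ η₂ := ((min_le_left _ _).trans (min_le_right _ _)).trans (min_le_right _ _)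
  have hδρ' : δ ≤ ρ' := ((min_le_right _ _).trans (min_le_left _ _)).trans (min_le_left _ _)
  have hδδ₅ : δ ≤ δ₅ := ((min_le_right _ _).trans (min_le_left _ _)).trans (min_le_right _ _)
  have hδδ₆ : δ ≤ δ₆ := (min_le_right _ _).trans (min_le_right _ _)
  -- a crossing of the two arcs in the windows is a zero of `g t` in the fold window
  have hcross : ∀ t s u, |t| < δ → |s - α| < η → |u - β| < η → Γ t s = Γ t u →
      |(Γ t s).1 - x₀| < ρ ∧ φ t (Γ t s).1 = s ∧ ψ t (Γ t s).1 = u ∧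
        g t ((Γ t s).1 - x₀) = 0 := by
    intro t s u htδ hs hu heq
    have ht₁ : |t| < δ₁ := htδ.trans_le hδδ₁
    have hx : |(Γ t s).1 - x₀| < ρ := (hboxα t s (htδ.trans_le hδη₁) (hs.trans_le hηη₁)).1
    have hφs : φ t (Γ t s).1 = s := hφl t s ht₁ (hs.trans_le hηδ₁)
    have hψu : ψ t (Γ t s).1 = u := by rw [heq]; exact hψl t u ht₁ (hu.trans_le hηδ₁)
    refine ⟨hx, hφs, hψu, ?_⟩
    have h2 : (Γ t s).2 = (Γ t u).2 := by rw [heq]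
    simp only [hg, hf, ha, hb, add_sub_cancel, hφs, hψu, h2, sub_self]
  refine ⟨η, hη0, hηmax', δ, hδ0, ?_, ?_, ?_, ?_⟩
  · -- injectivity on the window around `α`
    intro t s s' htδ hs hs' heq
    have ht₁ : |t| < δ₁ := htδ.trans_le hδδ₁
    calc s = φ t (Γ t s).1 := (hφl t s ht₁ (hs.trans_le hηδ₁)).symm
      _ = φ t (Γ t s').1 := by rw [heq]
      _ = s' := hφl t s' ht₁ (hs'.trans_le hηδ₁)
  · -- injectivity on the window around `β`
    intro t u u' htδ hu hu' heq
    have ht₁ : |t| < δ₁ := htδ.trans_le hδδ₁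
    calc u = ψ t (Γ t u).1 := (hψl t u ht₁ (hu.trans_le hηδ₁)).symm
      _ = ψ t (Γ t u').1 := by rw [heq]
      _ = u' := hψl t u' ht₁ (hu'.trans_le hηδ₁)
  · -- before: no crossing
    intro t s u ht1 ht2 hs hu heq
    have htδ : |t| < δ := abs_lt.2 ⟨ht1, by linarith⟩
    obtain ⟨hx, -, -, hg0'⟩ := hcross t s u htδ hs hu heq
    have hpos := hnone t ⟨by linarith [hδδ₂], ht2⟩ ((Γ t s).1 - x₀) (abs_lt.1 hx)
    exact hpos.ne' hg0'
  · -- after: exactly two crossings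
    intro t ht1 ht2
    have htδ : |t| < δ := abs_lt.2 ⟨by linarith, ht2⟩
    have ht₁ : |t| < δ₁ := htδ.trans_le hδδ₁
    have ht₆ : |t| < δ₆ := htδ.trans_le hδδ₆
    obtain ⟨y₁, y₂, hy₁, hy₁0, hy₂0, hy₂, hgy₁, hgy₂, hdy₁, hdy₂, huniq'⟩ :=
      htwo' t ⟨ht1, ht2.trans_le hδδ₅⟩
    obtain ⟨z₁, z₂, hz₁, hz₁0, hz₂0, hz₂, hgz₁, hgz₂, -, -, huniq⟩ :=
      htwo t ⟨ht1, ht2.trans_le hδδ₂⟩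
    -- the zeros of the small window are the zeros of the big window
    have hy₁ρ : y₁ ∈ Ioo (-ρ) ρ := ⟨by linarith, by linarith⟩
    have hy₂ρ : y₂ ∈ Ioo (-ρ) ρ := ⟨by linarith, by linarith⟩
    have hyz : y₁ = z₁ ∧ y₂ = z₂ := by
      rcases huniq y₁ hy₁ρ hgy₁ with h1 | h1 <;> rcases huniq y₂ hy₂ρ hgy₂ with h2 | h2
      · exact absurd (h1.trans h2.symm) (ne_of_lt (by linarith))
      · exact ⟨h1, h2⟩
      · exfalso; linarith
      · exact absurd (h1.trans h2.symm) (ne_of_lt (by linarith))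
    -- the two crossings
    set x₁ : ℝ := x₀ + y₁ with hx₁
    set x₂ : ℝ := x₀ + y₂ with hx₂
    have hx₁ρ' : |x₁ - x₀| < ρ' := by
      rw [hx₁, add_sub_cancel_left]; exact abs_lt.2 ⟨by linarith, by linarith⟩
    have hx₂ρ' : |x₂ - x₀| < ρ' := by
      rw [hx₂, add_sub_cancel_left]; exact abs_lt.2 ⟨by linarith, by linarith⟩
    have hx₁δ₁ : |x₁ - x₀| < δ₁ := by
      rw [hx₁, add_sub_cancel_left]; exact abs_lt.2 ⟨by linarith, by linarith⟩
    have hx₂δ₁ : |x₂ - x₀| < δ₁ := by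
      rw [hx₂, add_sub_cancel_left]; exact abs_lt.2 ⟨by linarith, by linarith⟩
    have hx₁δ₆ : |x₁ - x₀| < δ₆ := by
      rw [hx₁, add_sub_cancel_left]; exact abs_lt.2 ⟨by linarith, by linarith⟩
    have hx₂δ₆ : |x₂ - x₀| < δ₆ := by
      rw [hx₂, add_sub_cancel_left]; exact abs_lt.2 ⟨by linarith, by linarith⟩
    have htρ' : |t| < ρ' := htδ.trans_le hδρ'
    obtain ⟨hs₁, hu₁⟩ := hboxφψ t x₁ htρ' hx₁ρ'
    obtain ⟨hs₂, hu₂⟩ := hboxφψ t x₂ htρ' hx₂ρ'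
    have hmeet : ∀ {x y : ℝ}, x = x₀ + y → |x - x₀| < δ₁ → g t y = 0 →
        Γ t (φ t x) = Γ t (ψ t x) := by
      intro x y hxy hxδ hgy
      refine Prod.ext ?_ ?_
      · rw [hφr t x ht₁ hxδ, hψr t x ht₁ hxδ]
      · have h : f t x = 0 := by rw [hxy]; exact hgy
        simp only [hf, ha, hb, sub_eq_zero] at h
        exact h.symm
    have hmeet₁ := hmeet hx₁ hx₁δ₁ hgy₁
    have hmeet₂ := hmeet hx₂ hx₂δ₁ hgy₂
    have hfst₁ : (Γ t (φ t x₁)).1 = x₁ := hφr t x₁ ht₁ hx₁δ₁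
    have hfst₂ : (Γ t (φ t x₂)).1 = x₂ := hφr t x₂ ht₁ hx₂δ₁
    -- the crossing determinants are `∂ₓ f / (φₓ ψₓ)`
    have hdet : ∀ {x y : ℝ}, x = x₀ + y → |x - x₀| < δ₁ → |x - x₀| < δ₆ →
        |φ t x - α| < η → |ψ t x - β| < η →
        ∃ dφ dψ : ℝ, ((deriv (Γ t) (φ t x)).1 * (deriv (Γ t) (ψ t x)).2
            - (deriv (Γ t) (φ t x)).2 * (deriv (Γ t) (ψ t x)).1) * (dφ * dψ) = deriv (g t) y ∧
          0 < dφ * (D (0, α)).1 ∧ 0 < dψ * (D (0, β)).1 := by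
      intro x y hxy hxδ₁ hxδ₆ hφx hψx
      obtain ⟨hφ2, hψ2⟩ := hbox₆ t x ht₆ hxδ₆
      -- derivatives of the reparametrisations at `x`
      obtain ⟨dφ, hφ'⟩ : ∃ dφ : ℝ, HasDerivAt (φ t) dφ x :=
        ⟨_, hasDerivAt_curry_right (q := (t, x)) (hφ2.differentiableAt h20)⟩
      obtain ⟨dψ, hψ'⟩ : ∃ dψ : ℝ, HasDerivAt (ψ t) dψ x :=
        ⟨_, hasDerivAt_curry_right (q := (t, x)) (hψ2.differentiableAt h20)⟩
      -- chain rule along the arcs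
      have hcφ : HasDerivAt (fun x ↦ Γ t (φ t x)) (dφ • deriv (Γ t) (φ t x)) x :=
        (hγd t (φ t x)).scomp x hφ'
      have hcψ : HasDerivAt (fun x ↦ Γ t (ψ t x)) (dψ • deriv (Γ t) (ψ t x)) x :=
        (hγd t (ψ t x)).scomp x hψ'
      -- first components: the identity, so `dφ (Γₜ' s).1 = 1`
      have hball : Ioo (x₀ - δ₁) (x₀ + δ₁) ∈ 𝓝 x :=
        Ioo_mem_nhds (by linarith [(abs_lt.1 hxδ₁).1]) (by linarith [(abs_lt.1 hxδ₁).2])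
      have hidφ : HasDerivAt (fun x ↦ (Γ t (φ t x)).1) 1 x := by
        refine (hasDerivAt_id x).congr_of_eventuallyEq ?_
        filter_upwards [hball] with x' hx'
        exact hφr t x' ht₁ (abs_lt.2 ⟨by linarith [hx'.1], by linarith [hx'.2]⟩)
      have hidψ : HasDerivAt (fun x ↦ (Γ t (ψ t x)).1) 1 x := by
        refine (hasDerivAt_id x).congr_of_eventuallyEq ?_
        filter_upwards [hball] with x' hx'
        exact hψr t x' ht₁ (abs_lt.2 ⟨by linarith [hx'.1], by linarith [hx'.2]⟩)
      have h1φ : HasDerivAt (fun x ↦ (Γ t (φ t x)).1) ((dφ • deriv (Γ t) (φ t x)).1) x :=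
        (ContinuousLinearMap.fst ℝ ℝ ℝ).hasFDerivAt.comp_hasDerivAt x hcφ
      have h1ψ : HasDerivAt (fun x ↦ (Γ t (ψ t x)).1) ((dψ • deriv (Γ t) (ψ t x)).1) x :=
        (ContinuousLinearMap.fst ℝ ℝ ℝ).hasFDerivAt.comp_hasDerivAt x hcψ
      have e1φ : dφ * (deriv (Γ t) (φ t x)).1 = 1 := h1φ.unique hidφ
      have e1ψ : dψ * (deriv (Γ t) (ψ t x)).1 = 1 := h1ψ.unique hidψ
      -- second components: the heights
      have h2φ : HasDerivAt (a t) ((dφ • deriv (Γ t) (φ t x)).2) x :=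
        (ContinuousLinearMap.snd ℝ ℝ ℝ).hasFDerivAt.comp_hasDerivAt x hcφ
      have h2ψ : HasDerivAt (b t) ((dψ • deriv (Γ t) (ψ t x)).2) x :=
        (ContinuousLinearMap.snd ℝ ℝ ℝ).hasFDerivAt.comp_hasDerivAt x hcψ
      have hdf : deriv (f t) x = dψ * (deriv (Γ t) (ψ t x)).2 - dφ * (deriv (Γ t) (φ t x)).2 := by
        have e : f t = b t - a t := rfl
        rw [e, (h2ψ.sub h2φ).deriv]
        rfl
      have hdg : deriv (g t) y = deriv (f t) x := by
        have e : g t = fun y ↦ f t (x₀ + y) := rfl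
        rw [e, deriv_comp_const_add, ← hxy]
      refine ⟨dφ, dψ, ?_, ?_, ?_⟩
      · rw [hdg, hdf]
        linear_combination (dψ * (deriv (Γ t) (ψ t x)).2) * e1φ
          - (dφ * (deriv (Γ t) (φ t x)).2) * e1ψ
      · -- `dφ` has the sign of `(Γₜ' s).1`, which has the sign of `(Γ₀' α).1`
        have hsame : 0 < (D (0, α)).1 * (D (t, φ t x)).1 := by
          rw [mul_comm]
          exact mul_pos_of_abs_sub_lt
            (hboxα t (φ t x) (htδ.trans_le hδη₁) (hφx.trans_le hηη₁)).2
        rw [← hDeq t] at hsame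
        have hpos : 0 < dφ * (deriv (Γ t) (φ t x)).1 := by rw [e1φ]; exact one_pos
        exact mpp hpos hsame
      · have hsame : 0 < (D (0, β)).1 * (D (t, ψ t x)).1 := by
          rw [mul_comm]
          exact mul_pos_of_abs_sub_lt
            (hboxβ t (ψ t x) (htδ.trans_le hδη₂) (hψx.trans_le hηη₂)).2
        rw [← hDeq t] at hsame
        have hpos : 0 < dψ * (deriv (Γ t) (ψ t x)).1 := by rw [e1ψ]; exact one_pos
        exact mpp hpos hsame
    obtain ⟨dφ₁, dψ₁, hd₁, hφ₁, hψ₁⟩ := hdet hx₁ hx₁δ₁ hx₁δ₆ hs₁ hu₁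
    obtain ⟨dφ₂, dψ₂, hd₂, hφ₂, hψ₂⟩ := hdet hx₂ hx₂δ₁ hx₂δ₆ hs₂ hu₂
    -- the product of the two determinants is negative
    have hprod : ((deriv (Γ t) (φ t x₁)).1 * (deriv (Γ t) (ψ t x₁)).2
        - (deriv (Γ t) (φ t x₁)).2 * (deriv (Γ t) (ψ t x₁)).1)
        * ((deriv (Γ t) (φ t x₂)).1 * (deriv (Γ t) (ψ t x₂)).2
        - (deriv (Γ t) (φ t x₂)).2 * (deriv (Γ t) (ψ t x₂)).1) < 0 := by
      have hq : 0 < (dφ₁ * dψ₁) * (dφ₂ * dψ₂) := by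
        have hφφ : 0 < dφ₁ * dφ₂ := mpp hφ₁ hφ₂
        have hψψ : 0 < dψ₁ * dψ₂ := mpp hψ₁ hψ₂
        rw [show (dφ₁ * dψ₁) * (dφ₂ * dψ₂) = (dφ₁ * dφ₂) * (dψ₁ * dψ₂) by ring]
        exact mul_pos hφφ hψψ
      have hneg : deriv (g t) y₁ * deriv (g t) y₂ < 0 := mul_neg_of_neg_of_pos hdy₁ hdy₂
      rw [← hd₁, ← hd₂] at hneg
      set A := (deriv (Γ t) (φ t x₁)).1 * (deriv (Γ t) (ψ t x₁)).2
        - (deriv (Γ t) (φ t x₁)).2 * (deriv (Γ t) (ψ t x₁)).1 with hA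
      set B := (deriv (Γ t) (φ t x₂)).1 * (deriv (Γ t) (ψ t x₂)).2
        - (deriv (Γ t) (φ t x₂)).2 * (deriv (Γ t) (ψ t x₂)).1 with hB
      have e : A * (dφ₁ * dψ₁) * (B * (dφ₂ * dψ₂)) = (A * B) * ((dφ₁ * dψ₁) * (dφ₂ * dψ₂)) := by
        ring
      rw [e] at hneg
      by_contra hAB
      push Not at hAB
      exact absurd hneg (not_lt.2 (mul_nonneg hAB hq.le))
    refine ⟨φ t x₁, ψ t x₁, φ t x₂, ψ t x₂, hs₁, hs₂, hu₁, hu₂, hmeet₁, hmeet₂, ?_, ?_, ?_, ?_⟩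
    · rw [hfst₁, hfst₂, hx₁, hx₂]; linarith
    · -- uniqueness
      intro s u hs hu heq
      obtain ⟨hx, hφs, hψu, hg0'⟩ := hcross t s u htδ hs hu heq
      have hxmem : (Γ t s).1 - x₀ ∈ Ioo (-ρ) ρ := abs_lt.1 hx
      rcases huniq _ hxmem hg0' with h | h
      · left
        have hxe : (Γ t s).1 = x₁ := by rw [hx₁]; linarith [h, hyz.1]
        exact ⟨by rw [← hφs, hxe], by rw [← hψu, hxe]⟩
      · right
        have hxe : (Γ t s).1 = x₂ := by rw [hx₂]; linarith [h, hyz.2]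
        exact ⟨by rw [← hφs, hxe], by rw [← hψu, hxe]⟩
    · exact left_ne_zero_of_mul (ne_of_lt hprod)
    · exact sign_eq_neg_sign_of_mul_neg hprod

end Literature.Analysis.Calculus
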